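/-
Copyright (c) 2026. All rights reserved.
Released under Apache 2.0 license as described in the file LICENSE.
Authors: abc-iut cell, cone prover seat abc-iut-w6-d028 (wave W6, block C).
-/
import Literature.AnabelianGeometry.SemiGraphs.TemperedAbsolutenessCyclotomeNonVacuity
import HarnessLib

/-!
# [SemiAnbd] §6 Thm. 6.12 over the origin certificate `AbsolutenessOrigin`: the universal closure is FALSE
# (schema verdict for FACT-LIST row F-1653)

Mochizuki, *Semi-graphs of anabelioids*, Publ. RIMS **42** (2006) [SemiAnbd], §6 p. 78 (author's ms.),
Thm. 6.12 (Rigidity of Cuspidal Geometric Decomposition Groups). [cite: MochizukiSemiAnbd2006, Thm 6.12 p.78]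

PROOF-ONLY companion (no `def`, nothing restated) of abc-iut-L3's `TemperedAbsoluteness.lean` (typed node
`AbsolutenessOrigin.CuspidalCyclotomicRigidityHolds`) and of abc-iut-w5-d040's vacuity-lane file
`TemperedAbsolutenessCyclotomeNonVacuity.lean`, which realises over the toy hyperbolic §6 datum BOTH a
cyclotome transport satisfying Thm. 6.12's predicate and one violating it
(`CyclotomeTransport.exists_toyHyperbolic_not_cuspidalCyclotomicRigidity`: `cycloOf α = id` while `α`
inverts `I_x`).  Sibling of `TemperedAbsolutenessSchemaNegative.lean` (Cor. 6.10 / 6.11; satisfiability of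
all three nodes), split off so that it alone carries the cyclotome imports.

* `not_forall_cuspidalCyclotomicRigidityHolds` (F-1653): the all-certifying certificate certifies the
  violating transport, so not every `Ω` satisfies the node — the universal closure is FALSE.

HONEST FRAMING: a statement about the INTERFACE (free certificate + junk transport), not about the printed
Thm. 6.12 for hyperbolic curves with their natural cyclotomes; the node must be consumed at the genuine
certificate, as designed.  No side is taken on [IUTchIII] Cor. 3.12; typed ≠ proved; schema-refuted ≠ refuted.
-/

noncomputable section

namespace Literature.AnabelianGeometry.SemiGraphs

namespace AbsolutenessOrigin

variable (p : ℕ) [Fact p.Prime]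

/-- **F-1653, universal closure REFUTED.** Not every certificate satisfies Thm. 6.12 as typed: the
all-certifying certificate certifies the toy hyperbolic §6 datum together with abc-iut-w5-d040's cyclotome
transport violating the rigidity predicate (`CyclotomeTransport.exists_toyHyperbolic_not_cuspidalCyclotomicRigidity`).
[cite: MochizukiSemiAnbd2006, Thm 6.12 p.78] -/
theorem not_forall_cuspidalCyclotomicRigidityHolds :
    ¬ ∀ Ω : AbsolutenessOrigin p, Ω.CuspidalCyclotomicRigidityHolds := by
  intro h
  obtain ⟨T, hT⟩ := CyclotomeTransport.exists_toyHyperbolic_not_cuspidalCyclotomicRigidity p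
  let Ω : AbsolutenessOrigin p :=
    { IsHyperbolicCurveOrigin := fun _ => True
      IsDomHomOrigin := fun _ => True
      IsDLocOrigin := fun _ => True
      IsFlagsOrigin := fun _ => True
      IsStructuresOrigin := fun _ => True
      IsKummerOrigin := fun _ => True
      IsKummerTransportOrigin := fun _ => True
      IsCyclotomeOrigin := fun _ => True }
  exact hT (h Ω _ _ T trivial trivial trivial)

/-- Hence the typed node is INDEPENDENT of the interface: it holds at some certificate (any certificate
certifying no curve, e.g. vacuously) and fails at another (the all-certifying one) — its truth value is
carried entirely by the certificate. [cite: MochizukiSemiAnbd2006, Thm 6.12 p.78] -/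
theorem exists_cuspidalCyclotomicRigidityHolds_and_exists_not :
    (∃ Ω : AbsolutenessOrigin p, Ω.CuspidalCyclotomicRigidityHolds) ∧
      ∃ Ω : AbsolutenessOrigin p, ¬ Ω.CuspidalCyclotomicRigidityHolds := by
  refine ⟨⟨{ IsHyperbolicCurveOrigin := fun _ => False
             IsDomHomOrigin := fun _ => False
             IsDLocOrigin := fun _ => False
             IsFlagsOrigin := fun _ => False
             IsStructuresOrigin := fun _ => False
             IsKummerOrigin := fun _ => False
             IsKummerTransportOrigin := fun _ => False
             IsCyclotomeOrigin := fun _ => False }, fun _ _ _ hX _ _ => hX.elim⟩, ?_⟩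
  exact not_forall.1 (not_forall_cuspidalCyclotomicRigidityHolds p)

end AbsolutenessOrigin

end Literature.AnabelianGeometry.SemiGraphs

end
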